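import Mathlib
import HarnessLib
import Literature.Probability.LatticeModels.TorusFourierWeightedConvolution
import Summits.HubbardSuperconductivity.HubbardSuperconductivity.Theorems.KLProgrammeKLRegimeEngineFrameShiftMomentResponse
import Summits.HubbardSuperconductivity.HubbardSuperconductivity.Theorems.KLProgrammeKLRegimeEngineFrameShiftSymbolMomentsFlow

/-!
# K3 gen-8-FLOW (stmt 20437 `KLRegimeEngineV17F2`, stub (C)): DOOR (B) ASSEMBLED ON THE FLOW FRAMES — the position moments of order `r` of the
# frame-shift response of the two-leg kernel between `K_n` and `K_{n+1}`, from the kernel moments `N, S` and the PIECE jet tables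

Cell gate-hubbard-kl, seat p2 g11.  The composition of the two halves of door (B) = S6 door (2): the response door
`…EngineFrameShiftMomentResponse.moment_selfEnergy_frameShift_sub_le` (p536707; loop part through door (1), tree part through the symbol moments `D`) with
the (S)-half supplier on the flow `…EngineFrameShiftSymbolMomentsFlow.frameShift_symbol_moment_le_flow` (p545182; `D = 21·3^r·𝒥` from the piece tables),
at the engine's weight `w = (1+|x̃₀|+|x̃₁|)^r` (non-negative and submultiplicative: `Literature/…/TorusFourierWeightedConvolution.momentWeight₂_pow_add_le`):

* **`moment_selfEnergy_flowStep_sub_le`** — with `s_j = uvSymbolCT … K_j Λ`, `K₀ = K_n`, `K₁ = K_{n+1}`: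
  `Σ_x (1+|x̃₀|+|x̃₁|)^r·‖𝔉⁻¹[k⃗ ↦ Σ[𝒢(C^{K_{n+1}}_{>Λ},V_U)]((ω_i,k⃗),σ) − Σ[𝒢(C^{K_n}_{>Λ},V_U)]((ω_i,k⃗),σ)](x)‖ ≤
   2|β|L²·(12·(2L²(2B₁+1)βL²(2β/Λ)·frameDist K_{n+1} K_n)·N + 2·(21·3^r·𝒥)·S²)`.
  Inputs: `Z_t ≠ 0`, four-leg moments `≤ N`, two-leg moments `≤ S` along the interpolation (registrant, (b)-F tower); piece tables `pj`, the fit and `𝒥`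
  (registrant's arithmetic over `FlowPieceJetsAt` / `…FlowPieceJetsAllOrders`); `frameDist K_{n+1} K_n ≤ Gfr₀|U|4^{−2n}` by `frameDist_klFlowFrameU_succ_le`.
  The reading then follows by `sum_mul_abs_torusCosCoeff_re_le` → `norm_iteratedFDeriv_evalM_symInterp_le_pure_moments` → c4a-1's chain rule.

Proofs only; nothing about the sizes is asserted; nothing asserts superconductivity.  References: Salmhofer 1998 §3.1, BGM 2006 §2.1 (2.36aa), §3 (3.2)–(3.8)
[cite: BenfattoGiulianiMastropietro2006].
-/

noncomputable section

namespace Summit.HubbardSuperconductivity.HubbardSuperconductivity.Theorems.EngineV8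

set_option linter.dupNamespace false -- summit = problem name (single-conjunct summit), D-0017

open Finset Literature.MathematicalPhysics.QuantumLattice Literature.Probability.LatticeModels GrassmannAlgebra Set
open Summit.HubbardSuperconductivity.HubbardSuperconductivity.Theorems.KLRegimeSplit
open scoped Nat

variable {L M : ℕ} [NeZero L] [NeZero M]

/-- **DOOR (B) ON THE FLOW FRAMES** — the position moments of order `r` of the frame-shift response of the two-leg kernel between `K_n` and `K_{n+1}` at
the reading frequency `ω_i`: loop part linear in `frameDist K_{n+1} K_n` (door (1)), tree part linear in the piece-table size `𝒥` (the (S)-half supplier on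
the flow), both against the kernel moments `N`, `S` along the interpolation. -/
theorem moment_selfEnergy_flowStep_sub_le {B₁ : ℝ} (hB' : ∀ y, |deriv salmhoferCutoff y| ≤ B₁) {β : ℝ} (hβ : 0 < β) {Λ : ℝ} (hΛ : 0 < Λ)
    (μ U : ℝ) (n : ℕ) {s₀ s₁ : FreqMomentum L M × Fin 2 → ℂ} (hs₀ : s₀ = uvSymbolCT L M β μ (klFlowFrameU L M β U μ n) Λ)
    (hs₁ : s₁ = uvSymbolCT L M β μ (klFlowFrameU L M β U μ (n + 1)) Λ) (i : MatsubaraIdx M) (σ : Fin 2) (r : ℕ)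
    (hZ : ∀ t ∈ Set.Icc (0 : ℝ) 1, effPartitionFn ℂ (normalCovariance L M s₀ + ((t : ℂ)) • (normalCovariance L M s₁ - normalCovariance L M s₀))
      (hubbardInteraction L M β U) ≠ 0)
    {N S : ℝ}
    (hN : ∀ t ∈ Set.Icc (0 : ℝ) 1, ∀ A : HubbardFieldIdx L M,
      ∑ x : TorusSite 2 L, (1 + ((x 0).valMinAbs.natAbs : ℝ) + ((x 1).valMinAbs.natAbs : ℝ)) ^ r * ‖torusFourierInv (fun kv : TorusSite 2 L =>
        kernel ℂ (effAction ℂ (normalCovariance L M s₀ + ((t : ℂ)) • (normalCovariance L M s₁ - normalCovariance L M s₀))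
          (hubbardInteraction L M β U)) 4
          (Fin.snoc (Fin.snoc ![((((i, kv), σ), 0) : HubbardFieldIdx L M), (((i, kv), σ), 1)] (A.1, 1 - A.2) : Fin 3 → HubbardFieldIdx L M) A)) x‖ ≤ N)
    (hS : ∀ t ∈ Set.Icc (0 : ℝ) 1,
      ∑ x : TorusSite 2 L, (1 + ((x 0).valMinAbs.natAbs : ℝ) + ((x 1).valMinAbs.natAbs : ℝ)) ^ r * ‖torusFourierInv (fun kv : TorusSite 2 L =>
        kernel ℂ (effAction ℂ (normalCovariance L M s₀ + ((t : ℂ)) • (normalCovariance L M s₁ - normalCovariance L M s₀))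
          (hubbardInteraction L M β U)) 2 ![((((i, kv), σ), 0) : HubbardFieldIdx L M), (((i, kv), σ), 1)]) x‖ ≤ S)
    {N' : ℕ} {B : ℝ} (hB1 : 1 ≤ B) (hB : ∀ l ≤ N', ∀ t, ‖iteratedDeriv l salmhoferCutoff t‖ ≤ B) (hN' : r + 4 ≤ N')
    {pj : ℕ → ℕ → ℝ} (hpj : ∀ m ≤ n, ∀ j ≤ r + 2, ∀ q : Momentum, ‖iteratedFDeriv ℝ j (evalM (klFlowPiece L M β U μ m)) q‖ ≤ pj m j)
    {d : ℝ} (hfit : ∀ j, 1 ≤ j → j ≤ r + 2 → 4 + ∑ m ∈ range n, pj m j + pj n j ≤ d * (6 / max |matsubaraFreq β M i| (Λ / 2)) ^ (j - 1))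
    {J : ℝ}
    (hJ : ∀ k ≤ r + 2, (Real.pi / 2) ^ k * ∑ j ∈ Finset.range (k + 1), (k.choose j : ℝ) *
      (j ! * ((2 * (β * (L : ℝ) ^ 2) * B * (2 / max |matsubaraFreq β M i| (Λ / 2)) ^ 2) * j !) *
        (max d 1 * (6 / max |matsubaraFreq β M i| (Λ / 2))) ^ j) * pj n (k - j) ≤ J) :
    ∑ x : TorusSite 2 L, (1 + ((x 0).valMinAbs.natAbs : ℝ) + ((x 1).valMinAbs.natAbs : ℝ)) ^ r * ‖torusFourierInv (fun kv : TorusSite 2 L =>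
        selfEnergy L M β (effAction ℂ (normalCovariance L M s₁) (hubbardInteraction L M β U)) (i, kv) σ -
          selfEnergy L M β (effAction ℂ (normalCovariance L M s₀) (hubbardInteraction L M β U)) (i, kv) σ) x‖ ≤
      2 * (|β| * (L : ℝ) ^ 2) *
        (12 * (2 * (L : ℝ) ^ 2 * ((2 * B₁ + 1) * (β * (L : ℝ) ^ 2)) * (2 * β / Λ) *
            frameDist (klFlowFrameU L M β U μ (n + 1)) (klFlowFrameU L M β U μ n)) * N + 2 * (21 * 3 ^ r * J) * S ^ 2) := by
  have hw0 : ∀ x : TorusSite 2 L, 0 ≤ (1 + ((x 0).valMinAbs.natAbs : ℝ) + ((x 1).valMinAbs.natAbs : ℝ)) ^ r := fun x => by positivity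
  have hw : ∀ x y : TorusSite 2 L, (1 + (((x + y) 0).valMinAbs.natAbs : ℝ) + (((x + y) 1).valMinAbs.natAbs : ℝ)) ^ r ≤
      (1 + ((x 0).valMinAbs.natAbs : ℝ) + ((x 1).valMinAbs.natAbs : ℝ)) ^ r * (1 + ((y 0).valMinAbs.natAbs : ℝ) + ((y 1).valMinAbs.natAbs : ℝ)) ^ r :=
    fun x y => momentWeight₂_pow_add_le r x y
  have hD : ∑ x : TorusSite 2 L, (1 + ((x 0).valMinAbs.natAbs : ℝ) + ((x 1).valMinAbs.natAbs : ℝ)) ^ r *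
      ‖torusFourierInv (fun kv : TorusSite 2 L => s₁ ((i, kv), σ) - s₀ ((i, kv), σ)) x‖ ≤ 21 * 3 ^ r * J := by
    subst hs₀ hs₁
    exact frameShift_symbol_moment_le_flow hβ hΛ hB1 hB r hN' U μ n i σ hpj hfit hJ
  exact moment_selfEnergy_frameShift_sub_le hB' hβ hΛ μ U (klFlowFrameU L M β U μ n) (klFlowFrameU L M β U μ (n + 1)) hs₀ hs₁ i σ hw0 hw
    hZ hN hS hD

end Summit.HubbardSuperconductivity.HubbardSuperconductivity.Theorems.EngineV8

end
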